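import Mathlib
import Summits.Ventures.PercRepro2.SLevelCD
import Summits.Ventures.PercRepro2.RVBridge

/-!
# (CD) ⟹ (i), (ii) and (J1₁) in p1's `CaseOne` vocabulary (blind cell PercRepro2, mine-c g12)

`SLevelCD.lean` states (CD) at `S`-level and derives (i) at `S`-level (`covS_indS_phi_nonpos_of_cd`) and
(SC) / `J1RV.RVTable` (`rvTable_of_cd`). Here the two halves are carried to p1's Props:
* **`iExpr_eq_probs`** — `CaseOne.iExpr` in event probabilities (the (i)-twin of `CaseOne.iiExpr_eq_probs`);
* **`iExpr_eq_neg_covS`** — `CaseOne.iExpr = −covS (indS b) φ` (typer-1's `covS_indS_phi_eq`, the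
  `Dpd_eq` / `Dpdo_eq` / `compl_connEvent_eq_Q` bridges and the set bookkeeping);
* **`zSplitI_of_cd`** — (CD) ⟹ `CaseOne.ZSplitI` = (i);
* **`zSplitII_of_cd`** — (CD) ⟹ `CaseOne.ZSplitII` = (ii) (through `rvTable_of_cd` and `J1RV.RVTable_iff`);
* **`jOneOne_of_cd`** — (CD) ⟹ `CaseOne.JOneOne` = (J1₁) (p1's `jOneOne_of_i_of_ii`).
So ONE covariance statement on the revealed cluster `C₁` is above the whole case-1 unit of the (J1) line.
Nothing about (CD) itself is claimed. -/

namespace Summit.Ventures.PercRepro2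

open UnionCluster

namespace SLevel

section Bridge

variable {V : Type*} {E : Type*} [Fintype E] [DecidableEq E] [Fintype V] [DecidableEq V]
  {R : Type*} [Field R] [LinearOrder R] [IsStrictOrderedRing R]

variable (p : E → R) (ends : E → Sym2 V) (o a₁ a₂ a₃ b : V)

omit [Fintype V] [DecidableEq V] [LinearOrder R] [IsStrictOrderedRing R] in
/-- `CaseOne.iExpr` in event probabilities (the (i)-twin of `CaseOne.iiExpr_eq_probs`). -/
lemma iExpr_eq_probs :
    CaseOne.iExpr p ends o a₁ a₂ a₃ b =
      -(prob p (connEvent ends a₁ a₂)ᶜ *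
          (CaseOne.Dpd p ends a₁ a₂ a₃ * prob p (connEvent ends a₁ b ∩ connEvent ends a₁ a₃ ∩
              connEvent ends a₂ o ∩ (connEvent ends a₁ a₂)ᶜ) -
            CaseOne.Dpdo p ends o a₁ a₂ a₃ * prob p (connEvent ends a₁ b ∩ connEvent ends a₁ a₃ ∩
              (connEvent ends a₁ a₂)ᶜ)) -
        prob p (connEvent ends a₁ b ∩ (connEvent ends a₁ a₂)ᶜ) *
          (CaseOne.Dpd p ends a₁ a₂ a₃ * prob p (connEvent ends a₁ a₃ ∩ connEvent ends a₂ o ∩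
              (connEvent ends a₁ a₂)ᶜ) -
            CaseOne.Dpdo p ends o a₁ a₂ a₃ * prob p (connEvent ends a₁ a₃ ∩ (connEvent ends a₁ a₂)ᶜ))) := by
  unfold CaseOne.iExpr CaseOne.zFun
  have e1 : expect p (fun ω => (connEvent ends a₁ b).indicator (1 : Config E → R) ω *
      ((connEvent ends a₁ a₃).indicator 1 ω *
        (CaseOne.Dpd p ends a₁ a₂ a₃ * (connEvent ends a₂ o).indicator 1 ω -
          CaseOne.Dpdo p ends o a₁ a₂ a₃)) * ((connEvent ends a₁ a₂)ᶜ).indicator 1 ω) =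
      expect p (fun ω => ((connEvent ends a₁ b).indicator (1 : Config E → R) ω *
        (connEvent ends a₁ a₃).indicator 1 ω) *
        (CaseOne.Dpd p ends a₁ a₂ a₃ * (connEvent ends a₂ o).indicator 1 ω -
          CaseOne.Dpdo p ends o a₁ a₂ a₃) * ((connEvent ends a₁ a₂)ᶜ).indicator 1 ω) := by
    congr 1
    funext ω
    ring
  rw [e1, CaseOne.expect_mul_affine, CaseOne.expect_mul_affine]
  simp only [CaseOne.expect_ind4, CaseOne.expect_ind3, CaseOne.expect_ind2]

omit [Fintype E] [DecidableEq E] [Fintype V] [DecidableEq V] in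
/-- Set bookkeeping: the four events of `covS_indS_phi_eq` in the order of `iExpr_eq_probs`. -/
lemma set_i1 : connEvent ends a₁ b ∩ connEvent ends a₁ a₃ ∩ connEvent ends a₂ o ∩
      avoidAll ends a₂ {a₁} =
    avoidAll ends a₂ {a₁} ∩ connEvent ends a₁ a₃ ∩ connEvent ends a₂ o ∩ connEvent ends a₁ b := by
  ext ω; simp only [Set.mem_inter_iff]; tauto

omit [Fintype E] [DecidableEq E] [Fintype V] [DecidableEq V] in
/-- Set bookkeeping (2). -/
lemma set_i2 : connEvent ends a₁ b ∩ connEvent ends a₁ a₃ ∩ avoidAll ends a₂ {a₁} =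
    avoidAll ends a₂ {a₁} ∩ connEvent ends a₁ a₃ ∩ connEvent ends a₁ b := by
  ext ω; simp only [Set.mem_inter_iff]; tauto

omit [Fintype E] [DecidableEq E] [Fintype V] [DecidableEq V] in
/-- Set bookkeeping (3). -/
lemma set_i3 : connEvent ends a₁ b ∩ avoidAll ends a₂ {a₁} =
    avoidAll ends a₂ {a₁} ∩ connEvent ends a₁ b := by
  ext ω; simp only [Set.mem_inter_iff]; tauto

omit [Fintype E] [DecidableEq E] [Fintype V] [DecidableEq V] in
/-- Set bookkeeping (4). -/
lemma set_i4 : connEvent ends a₁ a₃ ∩ connEvent ends a₂ o ∩ avoidAll ends a₂ {a₁} =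
    avoidAll ends a₂ {a₁} ∩ connEvent ends a₁ a₃ ∩ connEvent ends a₂ o := by
  ext ω; simp only [Set.mem_inter_iff]; tauto

omit [Fintype E] [DecidableEq E] [Fintype V] [DecidableEq V] in
/-- Set bookkeeping (5). -/
lemma set_i5 : connEvent ends a₁ a₃ ∩ avoidAll ends a₂ {a₁} =
    avoidAll ends a₂ {a₁} ∩ connEvent ends a₁ a₃ := by
  ext ω; simp only [Set.mem_inter_iff]; tauto

omit [DecidableEq V] [LinearOrder R] [IsStrictOrderedRing R] in
/-- **`CaseOne.iExpr = −covS (1[b ∈ ·]) φ`**: p1's cleared (i) is the negative of the `S`-level covariance. -/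
theorem iExpr_eq_neg_covS :
    CaseOne.iExpr p ends o a₁ a₂ a₃ b = -covS p ends a₁ a₂ (indS b) (phi p ends o a₁ a₂ a₃) := by
  rw [iExpr_eq_probs, covS_indS_phi_eq, J1RV.Dpd_eq, J1RV.Dpdo_eq, CovForm.compl_connEvent_eq_Q,
    set_i1, set_i2, set_i3, set_i4, set_i5]

omit [DecidableEq V] in
/-- **(CD) ⟹ (i)** (`CaseOne.ZSplitI`). -/
theorem zSplitI_of_cd (h : CD p ends o a₁ a₂ a₃) : CaseOne.ZSplitI p ends o a₁ a₂ a₃ b := by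
  unfold CaseOne.ZSplitI
  rw [iExpr_eq_neg_covS]
  linarith [covS_indS_phi_nonpos_of_cd p ends o a₁ a₂ a₃ b h]

omit [DecidableEq V] in
/-- **(CD) ⟹ (ii)** (`CaseOne.ZSplitII`). -/
theorem zSplitII_of_cd (hp : IsProbVec p) (h : CD p ends o a₁ a₂ a₃) :
    CaseOne.ZSplitII p ends o a₁ a₂ a₃ b :=
  (J1RV.RVTable_iff p ends o a₁ a₂ a₃ b).1 (rvTable_of_cd p ends o a₁ a₂ a₃ b hp h)

omit [DecidableEq V] in
/-- **(CD) ⟹ (J1₁)** (`CaseOne.JOneOne`): the single `S`-level covariance statement is above the whole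
case-1 unit of the (J1) line. -/
theorem jOneOne_of_cd (hp : IsProbVec p) (h : CD p ends o a₁ a₂ a₃) :
    CaseOne.JOneOne p ends o a₁ a₂ a₃ b :=
  CaseOne.jOneOne_of_i_of_ii p ends o a₁ a₂ a₃ b (zSplitI_of_cd p ends o a₁ a₂ a₃ b h)
    (zSplitII_of_cd p ends o a₁ a₂ a₃ b hp h)

end Bridge

end SLevel

end Summit.Ventures.PercRepro2
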